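/-
Copyright: lit-balaban Phase-2 proof seat p27 (gen 37).  Statement-level skeleton of a published paper; no proof claims beyond what the
kernel checks below.
-/
import Literature.MathematicalPhysics.QuantumFieldTheory.BalabanImbrieJaffe1984to88.BIJ88NeumannPropagatorSmallFieldCloseHolder
import Literature.MathematicalPhysics.QuantumFieldTheory.BalabanImbrieJaffe1984to88.BIJ88NeumannPropagatorSmallFieldCloseRegion

/-!
# [BalabanImbrieJaffe1985] §7.3 p. 326 ⟵ [Balaban1983RegularityDecay] Theorem p. 573, (1.9), (1.11)–(1.12): **THE `δG_k(□, Ω)` HÖLDER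
# MEMBER (ORDER `1+α`) FOR GENERAL NESTED `k`-BLOCK UNIONS `□ ⊆ Ω` OF THE TORUS, HYPOTHESIS-FREE UNDER THE BLOCK-SCALE PLAQUETTE
# SMALLNESS `(L^{2k}θ)² ≤ 1/500` ALONE** — the four (H1.10″) region inputs taken BY NAME from p30's packaging

T. Bałaban, *Regularity and decay of lattice Green's functions*, Commun. Math. Phys. **89** (1983) 571–597 [Balaban1983RegularityDecay]
(= [7] of [BalabanImbrieJaffe1985]), Theorem p. 573 [PDF 3], (1.9): *"1/|x − x′|^α |U(A(Γ_{x,x′}))(D^η_{A,μ}G_k(Ω,A)f)(x′) −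
(D^η_{A,μ}G_k(Ω,A)f)(x)| ≦ c₀exp(−δ₀dist({x,x′}, supp f))‖f‖_∞ for x, x′ ∈ Ω, and satisfying the condition dist({x,x′},Ω^c) ≧ R₀"*,
(1.11)–(1.12): *"If Ω ⊂ Ω₀, then for δG_k(Ω,Ω₀,A) = G_k(Ω,A) − G_k(Ω₀,A), we have the inequalities (1.5) and (1.6) (with the same
restrictions on x, x′) with the additional factor"* (1.12) *"on the right hand sides"* [the (1.12) display is BLANK on the held scan (`p0003.txt`
L23); by the audited transcription of record — r01's `BIJ85NeumannPropagatorRegularClose`, via [Balaban1982Higgs1] = CMP 85 Prop. 2.1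
(2.26) — it reads `exp(−δ₀ dist(supp f, Ω^c) − δ₀ dist({x, x′}, Ω^c))`, the point set being the PAIR `{x, x′}`; the theorems below take the
boundary distance against BOTH points (docfix of referee ref-5's D-g69-1 / D-g70-3: an earlier header presented this gloss inside the
quotation marks in single-`x` form)]; T. Bałaban,
J. Imbrie, A. Jaffe, *Renormalization of the Higgs model: minimizers, propagators and the stability of mean field theory*, Commun. Math.
Phys. **97** (1985) 299–329 [BalabanImbrieJaffe1985], §7.3 p. 326 [PDF 28] lines 18–22: *"The propagators arising from Δ_k(u_k), under the
restriction (7.3.1) on the gauge field, also satisfy the regularity and decay estimates of [7]."*  Rows **C1.Eq7.3.1-7.3.2** (owner r15) /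
front **C2S14**, cells C2.Eq2.31 / C2.Claim@263 (owner r18) / B4.Thm@573 (owner r01) — cells only, no head change.

statement-level skeleton of published theorems with citation tags; proofs where landed; nothing here is a claim about the Yang–Mills mass gap

PDFs held: `paper:balaban1983-cmp89-regularity-decay` (p. 573 = PDF 3, the Theorem (1.5)–(1.12)); `paper:balaban1985-cmp97-bij-higgs-minimizers`
(p. 326 = PDF 28) — both sentences re-read on the materialised pages by this seat (gens 34–37; same pages, same wording as quoted).

CITATION HEADER (lean-in-tree rule).  Part of the lit-balaban TYPED SKELETON (HOME `run/shared/lean/pub/lit-balaban/`), PHASE-2 proof seat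
p27 gen 37 (unit `lit-balaban-p27-g37`; TAKING #4 line HOME/STATUS.md 2026-08-23T07:43:41Z, free-target protocol G.5-34(d), window → 08:05Z; p30 g29
07:32:37Z: «if you want the Hölder δG member's cube/torus/region hypothesis-free instances filed from my side instead of yours, say so —
otherwise I leave them to you»).  WHAT THIS FILE IS: the general-region twin of this seat's `BIJ88NeumannPropagatorSmallFieldCloseHolderCubeTorus`
— `BIJ88NeumannPropagatorSmallFieldCloseHolder.closeHolder112_smallField_of_inputs110` / `closeHolder112_smallField_input110` (p356227: the
Hölder member of the `δG_k(□,Ω)` clause from the four (H1.10″) inputs, nested `k`-block unions `□ ⊆ Ω`) with the four inputs DISCHARGED BY NAME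
by p30 g29's packaging `BIJ88NeumannPropagatorSmallFieldCloseRegion.inputs110_smallPlaquette_region` («ONE packaging, not two», p30 → p27
07:48:38Z, agreed 08:04:20Z): for all nested `k`-block unions `□ ⊆ Ω` the block-scale smallness `2d′³(L^{2k}θ)² ≤ 1` and the four members
`hGB ∧ hGΩ ∧ hDB ∧ hDΩ` — LITERALLY the hypotheses of p30's `close112_smallField_deriv_of_inputs` and of this seat's `…_of_inputs110` — from
p34's REGION members `BIJ88NeumannPropagatorSmallFieldRegionSup.decay110_smallPlaquette_region_uniform` (p356532: (1.10) value member, operator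
form, EVERY `k`-block union, every row, (7.3.1)-type fine-plaquette smallness with a `(d, L^k)`-only threshold) and
`BIJ88NeumannPropagatorSmallFieldRegionDeriv.decay110_smallPlaquette_region_deriv_uniform_input` (p357088: the covariant-derivative member on
the rows whose open `L^k`-ball lies in the region), at common constants, the thresholds following from `(L^{2k}θ)² ≤ 1/500` by p31's
arithmetic.  USED BY NAME, never restated: p30's packaging theorem, this seat's two `…110` theorems, p31's `gBox` / `IsBlockUnion`, p38's
`B5Ineq137Torus.T`, r18's `covD` / `cfg`, p30's `stairHol`, `plaqC` (`BIJ85AbelianStokes`).  p30 g29's `BIJ88NeumannPropagatorSmallFieldCloseRegion`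
(value and covariant-derivative members of the clause for general regions, hypothesis-free, and the packaging) is the sibling row of the same
table; nothing of it is restated here.

WHAT THIS FILE PROVES (theorems only; 0 `sorry`; standard axioms; no definition, no `Prop`-valued fact, no private lemma).  For
`2 ≤ d′ = d + 1 ≤ 3`, `L = ℓ + 1` odd `≥ 3`, `a > 0`, `0 ≤ α < 1` there are `c₃, δ₃ > 0` depending on these only such that on every torus of the
series (`P.d = d + 1`, `P.L = ℓ + 1`), at every level `1 ≤ k ≤ K` with `2(L^k − 1) + 4 < |T^{(0)}|`, for every `U(1)` field `u` with
`‖u(∂p) − 1‖ ≤ θ`, `0 ≤ θ`, `(L^{2k}θ)² ≤ 1/500` — `G_k(X,u) = gBox (α_kL^{kd′}) ε⁻¹ u k X`: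
* §1 **`closeHolder112_smallPlaquette_region`** — `∃ c₃, δ₃ > 0`: for all `k`-block unions `□ ⊆ Ω`, every pair of distinct rows `x₀ ≠ x₁`
  of `□` both with `dist_∞(x_i, T ∖ □) ≥ 17L^k`, every `μ`, every `f` supported in `□` (`F = ‖f‖_∞`, `0 ≤ D ≤ dist(x_i, supp f)`,
  `0 ≤ D_b ≤ dist(x_i, T∖□)`, `0 ≤ D_f ≤ dist(supp f, T∖□)`, p38's metric `T`):
  `(L^k/T(x₀,x₁))^α·‖U(Γ_{x₀,x₁})(D_uv)(⟨x₁,μ⟩) − (D_uv)(⟨x₀,μ⟩)‖ ≤ (L^kε)·c₃e^{−δ₃D/L^k}e^{−δ₃(D_b+D_f)/L^k}·F`, `v = G_k(□,u)f − G_k(Ω,u)f`,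
  `Γ` = p30's shortest staircase `stairHol`.
* §2 **`closeHolder112_smallPlaquette_region_input`** — §1 in the (H1.12)-Hölder INPUT BINDER SHAPE (direction first, `x₁ ≠ x₀`, deep rows as
  the ball conditions `T(x_i,y) ≤ 17L^k → y ∈ □`, no sign conditions on `D, D_b, D_f`).
With §1 the Hölder member of [Balaban1983RegularityDecay] (1.11)–(1.12) at small-plaquette `U(1)` fields is in the tree HYPOTHESIS-FREE in
`k`-uniform operator form for GENERAL nested `k`-block unions — HONEST-SCOPE item «only the pair (torus cube, whole torus)» of this seat's
cube/torus file discharged.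

HONEST SCOPE.  `U(1)` (p31's carrier); `2 ≤ d′ ≤ 3`; `L` odd `≥ 3`; `1 ≤ k ≤ K` with `2(L^k − 1) + 4 < |T|`; `0 ≤ α < 1` (referee ruling
G-ref1-32 on the printed «α < 0»); `k`-BLOCK UNIONS `□ ⊆ Ω` (p31's `IsBlockUnion`; the print's regions are unions of big blocks — a sub-case);
pairs at OUR depth `17L^k` below `T ∖ □` (our reading of the printed `R₀`; nothing nearer the boundary, no reflected kernels); the contour is
p30's explicit `stairHol`; ONE power of `L^kε` on the right; block-scale plaquette smallness as stated — THE PRINTED (7.3.1) constrains the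
unit-lattice plaquettes of `v` (p. 326 L13–14), the files' `θ` the fine plaquettes of `u`; `θ ≲ L^{−2k}` is the consistent block-scale reading
but nothing is asserted about the passage (p33's lane; referee ref-5 D-g64-1).  DIVERGENCE OF METHOD from the printed route as disclosed in the
member files ([Balaban1983RegularityDecay] p. 579 proves (1.11)–(1.12) by a random-walk cancellation; the tree applies p30's perturbative
interior Hölder estimate to the `N(u)`-harmonic difference, and p34's discrete Nash–Davies route for the region members).  This is an INPUT
of the order-`(1+θ)` member of [BalabanImbrieJaffe1988] (2.31) at small `u`, not that member.  Nothing here is summit progress, continuum or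
Clay.  Unit `lit-balaban-p27` (literature-prover-lit-balaban-p27-g37-0), HOME `run/shared/lean/pub/lit-balaban/`, 2026-08-23.
-/

open scoped BigOperators ComplexConjugate
open Finset Matrix

namespace Literature.MathematicalPhysics.QuantumFieldTheory.BalabanImbrieJaffe1984to88.BIJ88NeumannPropagatorSmallFieldCloseHolderRegion

open Literature.MathematicalPhysics.QuantumFieldTheory.Balaban1983to89
open BIJ88Sect3Statements (U1 toC cfg covD)
open BIJ85AbelianStokes (plaqC)
open BIJ88NeumannNoZeroModesTorus (IsBlockUnion)
open BIJ88NeumannPropagator227Torus (gBox)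
open BIJ88NeumannPropagatorSmallFieldCloseRegion (inputs110_smallPlaquette_region)
open BIJ85ScalarPropagatorHolderDecay (stairHol)
open BIJ88NeumannPropagatorSmallFieldCloseHolder (closeHolder112_smallField_of_inputs110 closeHolder112_smallField_input110)

noncomputable section

variable {P : Params}

/-! ## §1 The Hölder member for general nested `k`-block unions, hypothesis-free -/

/-- **[Balaban1983RegularityDecay] (1.9), (1.11)–(1.12), HÖLDER MEMBER (ORDER `1+α`), FOR GENERAL NESTED `k`-BLOCK UNIONS `□ ⊆ Ω` AT A
SMALL-PLAQUETTE `U(1)` FIELD, HYPOTHESIS-FREE** (this seat's `closeHolder112_smallField_of_inputs110` with its four (H1.10″) inputs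
discharged BY NAME by p30's `BIJ88NeumannPropagatorSmallFieldCloseRegion.inputs110_smallPlaquette_region`): for `1 ≤ d`, `d + 1 ≤ 3`,
`ℓ ≥ 1` with `ℓ + 1` odd, `a > 0`, `0 ≤ α < 1` there are `c₃, δ₃ > 0` such that for every volume
(`P.d = d + 1`, `P.L = ℓ + 1`), every `1 ≤ k ≤ K` with `2(L^k − 1) + 4 < |T|`, every `u` with `‖u(∂p) − 1‖ ≤ θ`, `0 ≤ θ`, `(L^{2k}θ)² ≤ 1/500`,
all `k`-block unions `□ ⊆ Ω`, every pair of distinct rows `x₀ ≠ x₁` of `□` with `dist_∞(x_i, T ∖ □) ≥ 17L^k`, every `μ` and every `f`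
supported in `□`: `(L^k/T(x₀,x₁))^α·‖U(Γ_{x₀,x₁})(D_uv)(⟨x₁,μ⟩) − (D_uv)(⟨x₀,μ⟩)‖ ≤ (L^kε)·c₃e^{−δ₃D/L^k}e^{−δ₃(D_b+D_f)/L^k}·F`,
`v = G_k(□,u)f − G_k(Ω,u)f`, `Γ = stairHol u x₀ x₁`.
[cite: Balaban1983RegularityDecay, Theorem p.573 (1.9), (1.11)–(1.12)] [cite: BalabanImbrieJaffe1985, (7.3.1) p.326] -/
theorem closeHolder112_smallPlaquette_region (d ℓ : ℕ) (hd1 : 1 ≤ d) (hd3 : d + 1 ≤ 3) (hℓ : 1 ≤ ℓ) (hodd : Odd (ℓ + 1)) {a : ℝ}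
    (ha : 0 < a) {α : ℝ} (hα0 : 0 ≤ α) (hα1 : α < 1) :
    ∃ c₃ δ₃ : ℝ, 0 < c₃ ∧ 0 < δ₃ ∧ ∀ (P : Params), P.d = d + 1 → P.L = ℓ + 1 →
      ∀ k : ℕ, 1 ≤ k → k ≤ P.K → 2 * (P.L ^ k - 1) + 4 < P.sitesPerDir 0 →
      ∀ (U : GaugeField P 0 U1) (θ : ℝ), 0 ≤ θ → (∀ (y : Balaban1983to89.Site P 0) (μ ν : Fin P.d), ‖plaqC U y μ ν - 1‖ ≤ θ) →
        (((P.L : ℝ) ^ k) ^ 2 * θ) ^ 2 ≤ 1 / 500 →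
      ∀ (B Ω : Finset (Balaban1983to89.Site P 0)), IsBlockUnion k B → IsBlockUnion k Ω → B ⊆ Ω →
      ∀ (x₀ x₁ : Balaban1983to89.Site P 0) (μ : Fin P.d), x₀ ≠ x₁ → x₀ ∈ B → x₁ ∈ B →
        (∀ w, w ∉ B → 17 * (P.L : ℝ) ^ k ≤ B5Ineq137Torus.T P 0 x₀ w) →
        (∀ w, w ∉ B → 17 * (P.L : ℝ) ^ k ≤ B5Ineq137Torus.T P 0 x₁ w) →
      ∀ (f : Balaban1983to89.Site P 0 → ℂ) (F D Db Df : ℝ), (∀ y, ‖f y‖ ≤ F) → (∀ y, y ∉ B → f y = 0) →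
        0 ≤ D → (∀ y, f y ≠ 0 → D ≤ B5Ineq137Torus.T P 0 x₀ y) → (∀ y, f y ≠ 0 → D ≤ B5Ineq137Torus.T P 0 x₁ y) →
        0 ≤ Db → (∀ w, w ∉ B → Db ≤ B5Ineq137Torus.T P 0 x₀ w) → (∀ w, w ∉ B → Db ≤ B5Ineq137Torus.T P 0 x₁ w) →
        0 ≤ Df → (∀ y, f y ≠ 0 → ∀ w, w ∉ B → Df ≤ B5Ineq137Torus.T P 0 y w) →
        ((P.L : ℝ) ^ k / B5Ineq137Torus.T P 0 x₀ x₁) ^ α *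
            ‖stairHol U x₀ x₁ *
                covD P.eps⁻¹ (cfg U) (gBox (B1RG242Torus.α P a k * (P.L : ℝ) ^ (k * P.d)) P.eps⁻¹ U k B *ᵥ f -
                  gBox (B1RG242Torus.α P a k * (P.L : ℝ) ^ (k * P.d)) P.eps⁻¹ U k Ω *ᵥ f) ⟨x₁, μ⟩ -
              covD P.eps⁻¹ (cfg U) (gBox (B1RG242Torus.α P a k * (P.L : ℝ) ^ (k * P.d)) P.eps⁻¹ U k B *ᵥ f -
                  gBox (B1RG242Torus.α P a k * (P.L : ℝ) ^ (k * P.d)) P.eps⁻¹ U k Ω *ᵥ f) ⟨x₀, μ⟩‖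
          ≤ P.spacing k * (c₃ * Real.exp (-(δ₃ * (((P.L : ℝ) ^ k)⁻¹ * D))) *
              Real.exp (-(δ₃ * (((P.L : ℝ) ^ k)⁻¹ * (Db + Df)))) * F) := by
  obtain ⟨c₀, δ₀, hc₀, hδ₀, HI⟩ := inputs110_smallPlaquette_region d ℓ hd1 hd3 hℓ hodd ha
  obtain ⟨c₃, δ₃, hc₃, hδ₃, H⟩ :=
    closeHolder112_smallField_of_inputs110 (d + 1) (ℓ + 1) (by omega) hd3 ⟨hodd, by omega⟩ ha hc₀ hδ₀ hα0 hα1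
  refine ⟨c₃, δ₃, hc₃, hδ₃, ?_⟩
  intro P hPd hPL k hk1 hkK hbig U θ hθ0 hθ hτ B Ω hB hΩ hsub
  obtain ⟨hsm1, hGB, hGΩ, hDB, hDΩ⟩ := HI P hPd hPL k hk1 hkK hbig U θ hθ0 hθ hτ B Ω hB hΩ hsub
  exact H P hPd hPL k hk1 hkK U θ hθ hsm1 B Ω hB hΩ hsub hGB hGΩ hDB hDΩ

/-! ## §2 The same in the (H1.12)-Hölder input binder shape -/

/-- **§1 IN THE (H1.12)-HÖLDER INPUT BINDER SHAPE** (this seat's `closeHolder112_smallField_input110` with its four (H1.10″) inputs discharged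
BY NAME by p30's `inputs110_smallPlaquette_region`): direction first, `x₁ ≠ x₀`, the deep rows as the ball conditions
`T(x_i,y) ≤ 17L^k → y ∈ □`, no sign conditions on `D, D_b, D_f`, transport `stairHol`.
[cite: Balaban1983RegularityDecay, Theorem p.573 (1.9), (1.11)–(1.12)] [cite: BalabanImbrieJaffe1985, (7.3.1) p.326] [cite: BalabanImbrieJaffe1988, p.263, (2.31)] -/
theorem closeHolder112_smallPlaquette_region_input (d ℓ : ℕ) (hd1 : 1 ≤ d) (hd3 : d + 1 ≤ 3) (hℓ : 1 ≤ ℓ) (hodd : Odd (ℓ + 1))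
    {a : ℝ} (ha : 0 < a) {α : ℝ} (hα0 : 0 ≤ α) (hα1 : α < 1) :
    ∃ c₃ δ₃ : ℝ, 0 < c₃ ∧ 0 < δ₃ ∧ ∀ (P : Params), P.d = d + 1 → P.L = ℓ + 1 →
      ∀ k : ℕ, 1 ≤ k → k ≤ P.K → 2 * (P.L ^ k - 1) + 4 < P.sitesPerDir 0 →
      ∀ (U : GaugeField P 0 U1) (θ : ℝ), 0 ≤ θ → (∀ (y : Balaban1983to89.Site P 0) (μ ν : Fin P.d), ‖plaqC U y μ ν - 1‖ ≤ θ) →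
        (((P.L : ℝ) ^ k) ^ 2 * θ) ^ 2 ≤ 1 / 500 →
      ∀ (B Ω : Finset (Balaban1983to89.Site P 0)), IsBlockUnion k B → IsBlockUnion k Ω → B ⊆ Ω →
      ∀ (μ : Fin P.d) (x₀ x₁ : Balaban1983to89.Site P 0), x₁ ≠ x₀ →
        (∀ y, B5Ineq137Torus.T P 0 x₀ y ≤ 17 * (P.L : ℝ) ^ k → y ∈ B) →
        (∀ y, B5Ineq137Torus.T P 0 x₁ y ≤ 17 * (P.L : ℝ) ^ k → y ∈ B) →
      ∀ (f : Balaban1983to89.Site P 0 → ℂ) (F D Db Df : ℝ), (∀ y, ‖f y‖ ≤ F) → (∀ y, y ∉ B → f y = 0) →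
        (∀ y, f y ≠ 0 → D ≤ B5Ineq137Torus.T P 0 x₀ y) → (∀ y, f y ≠ 0 → D ≤ B5Ineq137Torus.T P 0 x₁ y) →
        (∀ w, w ∉ B → Db ≤ B5Ineq137Torus.T P 0 x₀ w) → (∀ w, w ∉ B → Db ≤ B5Ineq137Torus.T P 0 x₁ w) →
        (∀ y, f y ≠ 0 → ∀ w, w ∉ B → Df ≤ B5Ineq137Torus.T P 0 y w) →
        ((P.L : ℝ) ^ k / B5Ineq137Torus.T P 0 x₀ x₁) ^ α *
            ‖stairHol U x₀ x₁ *
                covD P.eps⁻¹ (cfg U) (gBox (B1RG242Torus.α P a k * (P.L : ℝ) ^ (k * P.d)) P.eps⁻¹ U k B *ᵥ f -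
                  gBox (B1RG242Torus.α P a k * (P.L : ℝ) ^ (k * P.d)) P.eps⁻¹ U k Ω *ᵥ f) ⟨x₁, μ⟩ -
              covD P.eps⁻¹ (cfg U) (gBox (B1RG242Torus.α P a k * (P.L : ℝ) ^ (k * P.d)) P.eps⁻¹ U k B *ᵥ f -
                  gBox (B1RG242Torus.α P a k * (P.L : ℝ) ^ (k * P.d)) P.eps⁻¹ U k Ω *ᵥ f) ⟨x₀, μ⟩‖
          ≤ P.spacing k * (c₃ * Real.exp (-(δ₃ * (((P.L : ℝ) ^ k)⁻¹ * D))) *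
              Real.exp (-(δ₃ * (((P.L : ℝ) ^ k)⁻¹ * (Db + Df)))) * F) := by
  obtain ⟨c₀, δ₀, hc₀, hδ₀, HI⟩ := inputs110_smallPlaquette_region d ℓ hd1 hd3 hℓ hodd ha
  obtain ⟨c₃, δ₃, hc₃, hδ₃, H⟩ :=
    closeHolder112_smallField_input110 (d + 1) (ℓ + 1) (by omega) hd3 ⟨hodd, by omega⟩ ha hc₀ hδ₀ hα0 hα1
  refine ⟨c₃, δ₃, hc₃, hδ₃, ?_⟩
  intro P hPd hPL k hk1 hkK hbig U θ hθ0 hθ hτ B Ω hB hΩ hsub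
  obtain ⟨hsm1, hGB, hGΩ, hDB, hDΩ⟩ := HI P hPd hPL k hk1 hkK hbig U θ hθ0 hθ hτ B Ω hB hΩ hsub
  exact H P hPd hPL k hk1 hkK U θ hθ hsm1 B Ω hB hΩ hsub hGB hGΩ hDB hDΩ

end

end Literature.MathematicalPhysics.QuantumFieldTheory.BalabanImbrieJaffe1984to88.BIJ88NeumannPropagatorSmallFieldCloseHolderRegion
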